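import Literature.AlgebraicGeometry.HodgeTheory.FermatSurfaceModelRatio
import Literature.Geometry.Kaehler.HolomorphicStraightening
import HarnessLib

/-!
# Holomorphic models of the Fermat surface: coordinate charts from two affine coordinates, and lifted holomorphic curves

Family `hodge`, layer `Literature/AlgebraicGeometry/HodgeTheory`. PROOF FILE (theorems only; no
definition, no named fact — D-0026), continuing `FermatSurfaceModelRatio` /
`FermatSurfaceModelFibres`. For a holomorphic model `ψ : M → ℙ(ℂ⁴)` of the Fermat surface
(embedding onto `V(Σ xᵢᵐ)`, holomorphic affine coordinates, `dim_ℂ E = 2`), two of the three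
affine coordinates `y_j = x_j/x_k` of the affine piece `M_k` are local holomorphic coordinates
wherever the third one does not vanish (holomorphic implicit function theorem for
`1 + y₁ᵐ + y₂ᵐ + y₃ᵐ = 0`; Griffiths–Harris Ch. 0 §1): the pair `(y_i, y_j)` has injective,
hence onto, differential there, because `dZ̃_k(x)` is injective (`injective_liftDeriv`) and tangent
to the cone (`Σ_r y_r^{m−1} dy_r = 0`, so `dy_l` is a combination of `dy_i, dy_j` where
`y_l ≠ 0`). Proved here:

* `surjective_mfderiv_coordPair` — the differential of `x ↦ (y_i x, y_j x)` at such a point is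
  onto;
* `exists_coordChart` — **a local biholomorphism `e : M ⇀ ℂ² × ℂ⁰` at `x₀` whose first component
  is `(y_i, y_j)`** (`exists_holStraightening` of the tree), with source inside
  `M_k ∩ {y_l ≠ 0}`;
* `exists_liftedCurve` — **lifting holomorphic curves**: for `r₁, r₂` analytic at `t₀` with
  `(r₁ t₀, r₂ t₀) = (y_i x₀, y_j x₀)` there is `Γ : ℂ → M`, complex differentiable at `t₀`, with
  `Γ t₀ = x₀` and, for `t` near `t₀`, `Γ t ∈ e.source`, `Γ` complex differentiable at `t`,
  `y_i(Γ t) = r₁ t`, `y_j(Γ t) = r₂ t` (`Γ = e⁻¹ ∘ (r₁, r₂)`).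

These are the curves along which the holomorphic `2`-forms of the Fermat surface are read in
`FermatSurfaceEigenformsOnModels` (the `χ_β`-eigenform argument).

## References

* [GriffithsHarris1978] P. Griffiths, J. Harris, Principles of Algebraic Geometry (1978), Ch. 0
  §1 (holomorphic implicit and inverse function theorems).
* [Shioda1979HodgeFermat] T. Shioda, The Hodge conjecture for Fermat varieties, Math. Ann. 245
  (1979) 175–184, §1.
-/

noncomputable section

open scoped Manifold ContDiff Topology LinearAlgebra.Projectivization
open Set Filter Projectivization Function

namespace Literature.AlgebraicGeometry.HodgeTheory

open Literature.AlgebraicGeometry.Motives Literature.NumberTheory.Transcendental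
  Literature.Geometry.Kaehler

section Surface

variable {m : ℕ} {E : Type*} [NormedAddCommGroup E] [NormedSpace ℂ E] [FiniteDimensional ℂ E]
  {M : Type*} [TopologicalSpace M] [ChartedSpace E M] [IsManifold 𝓘(ℂ, E) ω M]
  {ψ : M → ℙ ℂ (Fin (2 + 2) → ℂ)}

/-! ### The pair of coordinates `(y_i, y_j)` -/

/-- The projection `w ↦ (w_i, w_j)` as a continuous linear map `ℂ⁴ → ℂ²`. [folklore] -/
theorem exists_pairProj (i j : Fin (2 + 2)) :
    ∃ P : (Fin (2 + 2) → ℂ) →L[ℂ] (Fin 2 → ℂ), ∀ w, P w = ![w i, w j] := by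
  refine ⟨ContinuousLinearMap.pi fun r ↦ ContinuousLinearMap.proj (![i, j] r), fun w ↦ ?_⟩
  funext r
  fin_cases r <;> simp

omit [FiniteDimensional ℂ E] [IsManifold 𝓘(ℂ, E) ω M] in
/-- The pair `x ↦ (y_i x, y_j x)` is holomorphic on `M_k` (the lift is). [folklore] -/
theorem mdifferentiableOn_coordPair (hψ : Continuous ψ) (hhol : HasHolomorphicCoords E ψ)
    (k i j : Fin (2 + 2)) :
    MDifferentiableOn 𝓘(ℂ, E) 𝓘(ℂ, Fin 2 → ℂ) (fun x ↦ ![projLift ψ k x i, projLift ψ k x j])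
      (liftDomain ψ k) := by
  obtain ⟨P, hP⟩ := exists_pairProj i j
  have hfun : (fun x ↦ ![projLift ψ k x i, projLift ψ k x j]) = P ∘ projLift ψ k := by
    funext x; rw [Function.comp_apply, hP]
  rw [hfun]
  intro x hx
  have _ := hψ
  exact (P.hasFDerivAt.hasMFDerivAt.comp_hasMFDerivWithinAt x
    (mdifferentiableOn_projLift ψ hhol k x hx).hasMFDerivWithinAt).mdifferentiableWithinAt

/-- **The differential of `(y_i, y_j)` is onto where the remaining coordinate `y_l` does not
vanish.** At `x ∈ M_k` with `y_l(x) ≠ 0` and `{i, j, k, l}` covering all four indices: if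
`dy_i(v) = dy_j(v) = 0` then `dZ̃_k(x) v` has vanishing `i, j, k`-components (the `k`-th is
always `0`) and, by tangency `Σ_r m y_r^{m−1} dy_r(v) = 0`, vanishing `l`-component, so `v = 0`
(`injective_liftDeriv`); injective endomorphisms of `ℂ²`-sized spaces are onto.
[cite: GriffithsHarris1978, Ch. 0 §1] -/
theorem surjective_mfderiv_coordPair [NeZero m] (hψ : Topology.IsEmbedding ψ)
    (hrange : Set.range ψ ⊆ projZeroLocus {fermatPolynomial ℂ 2 m}) (hhol : HasHolomorphicCoords E ψ)
    (h2 : Module.finrank ℂ E = 2) {k i j l : Fin (2 + 2)} (hcover : ∀ r, r = i ∨ r = j ∨ r = k ∨ r = l)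
    {x : M} (hx : x ∈ liftDomain ψ k) (hl : projLift ψ k x l ≠ 0) :
    Surjective (mfderiv 𝓘(ℂ, E) 𝓘(ℂ, Fin 2 → ℂ)
      (fun y ↦ ![projLift ψ k y i, projLift ψ k y j]) x) := by
  have hψc := hψ.continuous
  obtain ⟨P, hP⟩ := exists_pairProj i j
  have hfun : (fun y ↦ ![projLift ψ k y i, projLift ψ k y j]) = P ∘ projLift ψ k := by
    funext y; rw [Function.comp_apply, hP]
  have hg : MDifferentiableAt 𝓘(ℂ, E) 𝓘(ℂ, Fin (2 + 2) → ℂ) (projLift ψ k) x :=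
    (mdifferentiableOn_projLift ψ hhol k x hx).mdifferentiableAt
      ((isOpen_liftDomain ψ hψc k).mem_nhds hx)
  have hcomp := P.hasFDerivAt.hasMFDerivAt.comp x hg.hasMFDerivAt
  rw [hfun, hcomp.mfderiv]
  -- injectivity of `P ∘ dZ̃_k(x)` as a map `E → ℂ²`
  set L := liftDeriv (E := E) ψ k x with hLdef
  have hF := isHomogeneous_fermatPolynomial (k := ℂ) 2 m
  have hLinj := injective_liftDeriv ψ hF hψ hrange fermat_jacobian hhol h2 hx
  obtain ⟨hLJ, -⟩ := liftDeriv_eq_finInsertCLM_comp ψ hψc hhol hx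
  have hLk : ∀ v, L v k = 0 := fun v ↦ by rw [hLdef, hLJ]; simp
  have htan : ∀ v, ∑ r, (m : ℂ) * projLift ψ k x r ^ (m - 1) * L v r = 0 := fun v ↦ by
    have h := DFunLike.congr_fun (polyGrad_comp_mfderiv_projLift ψ hF hψc hrange hhol hx) v
    change polyGrad (fermatPolynomial ℂ 2 m) (projLift ψ k x) (L v) = 0 at h
    rw [polyGrad_apply] at h
    simp only [eval_pderiv_fermatPolynomial] at h
    exact h
  have hinj : Injective fun v : E ↦ P (L v) := by
    intro v w hvw
    rw [← sub_eq_zero] at hvw ⊢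
    rw [← map_sub, ← map_sub] at hvw
    set u := v - w
    apply hLinj
    rw [map_zero]
    have hPi : L u i = 0 := by
      have := congrFun ((hP (L u)).symm.trans hvw) 0; simpa using this
    have hPj : L u j = 0 := by
      have := congrFun ((hP (L u)).symm.trans hvw) 1; simpa using this
    have hPl : L u l = 0 := by
      have h := htan u
      have hsum : ∑ r, (m : ℂ) * projLift ψ k x r ^ (m - 1) * L u r =
          (m : ℂ) * projLift ψ k x l ^ (m - 1) * L u l := by
        refine Finset.sum_eq_single l (fun r _ hr ↦ ?_) (by simp)
        rcases hcover r with rfl | rfl | rfl | rfl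
        · rw [hPi, mul_zero]
        · rw [hPj, mul_zero]
        · rw [hLk, mul_zero]
        · exact absurd rfl hr
      rw [hsum] at h
      have hm0 : (m : ℂ) * projLift ψ k x l ^ (m - 1) ≠ 0 :=
        mul_ne_zero (Nat.cast_ne_zero.mpr (NeZero.ne m)) (pow_ne_zero _ hl)
      exact (mul_eq_zero.1 h).resolve_left hm0
    funext r
    rcases hcover r with rfl | rfl | rfl | rfl
    · exact hPi
    · exact hPj
    · exact hLk u
    · exact hPl
  -- onto, by dimensions
  have hdim : Module.finrank ℂ E = Module.finrank ℂ (Fin 2 → ℂ) := by simp [h2]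
  set T : E →ₗ[ℂ] (Fin 2 → ℂ) := (P : (Fin (2 + 2) → ℂ) →ₗ[ℂ] (Fin 2 → ℂ)).comp
    (L : E →ₗ[ℂ] (Fin (2 + 2) → ℂ)) with hT
  have hTinj : Injective T := hinj
  have hTsurj := (LinearMap.injective_iff_surjective_of_finrank_eq_finrank hdim).mp hTinj
  intro w
  obtain ⟨v, hv⟩ := hTsurj w
  exact ⟨v, hv⟩

/-! ### Coordinate charts -/

/-- **Two affine coordinates are local holomorphic coordinates where the third does not vanish.**
At `x₀ ∈ M_k` with `y_l(x₀) ≠ 0` (`{i, j, k, l}` all four indices) there is an open partial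
homeomorphism `e : M ⇀ ℂ² × ℂ⁰` with `x₀ ∈ e.source ⊆ M_k ∩ {y_l ≠ 0}`, holomorphic with
holomorphic inverse, and `(e y).1 = (y_i y, y_j y)` on its source (`exists_holStraightening` with
the onto differential of `surjective_mfderiv_coordPair`). In print: `(y_i, y_j)` are holomorphic
coordinates on the affine Fermat surface off `{y_l = 0}` (implicit function theorem).
[cite: GriffithsHarris1978, Ch. 0 §1] -/
theorem exists_coordChart [NeZero m] (hψ : Topology.IsEmbedding ψ)
    (hrange : Set.range ψ ⊆ projZeroLocus {fermatPolynomial ℂ 2 m}) (hhol : HasHolomorphicCoords E ψ)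
    (h2 : Module.finrank ℂ E = 2) {k i j l : Fin (2 + 2)} (hcover : ∀ r, r = i ∨ r = j ∨ r = k ∨ r = l)
    {x₀ : M} (hx₀ : x₀ ∈ liftDomain ψ k) (hl : projLift ψ k x₀ l ≠ 0) :
    ∃ e : OpenPartialHomeomorph M ((Fin 2 → ℂ) × (Fin 0 → ℂ)), x₀ ∈ e.source ∧
      e.source ⊆ liftDomain ψ k ∩ {x | projLift ψ k x l ≠ 0} ∧
      MDifferentiableOn 𝓘(ℂ, E) 𝓘(ℂ, (Fin 2 → ℂ) × (Fin 0 → ℂ)) e e.source ∧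
      MDifferentiableOn 𝓘(ℂ, (Fin 2 → ℂ) × (Fin 0 → ℂ)) 𝓘(ℂ, E) e.symm e.target ∧
      ∀ y ∈ e.source, (e y).1 = ![projLift ψ k y i, projLift ψ k y j] := by
  have hψc := hψ.continuous
  set U : Set M := liftDomain ψ k ∩ {x | projLift ψ k x l ≠ 0} with hU
  have hUo : IsOpen U := by
    have hc : ContinuousOn (fun x ↦ projLift ψ k x l) (liftDomain ψ k) :=
      (continuous_apply l).comp_continuousOn (mdifferentiableOn_projLift ψ hhol k).continuousOn
    exact hc.isOpen_inter_preimage (isOpen_liftDomain ψ hψc k) isOpen_ne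
  have hx₀U : x₀ ∈ U := ⟨hx₀, hl⟩
  have hf : MDifferentiableOn 𝓘(ℂ, E) 𝓘(ℂ, Fin 2 → ℂ)
      (fun x ↦ ![projLift ψ k x i, projLift ψ k x j]) U :=
    (mdifferentiableOn_coordPair hψc hhol k i j).mono inter_subset_left
  exact exists_holStraightening hUo hx₀U hf
    (surjective_mfderiv_coordPair hψ hrange hhol h2 hcover hx₀ hl) (by rw [h2])

/-! ### Lifted holomorphic curves -/

omit [FiniteDimensional ℂ E] [IsManifold 𝓘(ℂ, E) ω M] in
/-- **Lifting a holomorphic curve of the `(y_i, y_j)`-plane to `M`.** Given the chart `e` of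
`exists_coordChart` at `x₀` and functions `r₁, r₂` analytic at `t₀` with
`(r₁ t₀, r₂ t₀) = (y_i x₀, y_j x₀)`, the curve `Γ = e⁻¹ ∘ ((r₁, r₂), 0)` is complex differentiable
at `t₀`, `Γ t₀ = x₀`, and for `t` near `t₀`: `Γ t ∈ e.source`, `Γ` is complex differentiable at
`t`, `y_i(Γ t) = r₁ t`, `y_j(Γ t) = r₂ t`. [cite: GriffithsHarris1978, Ch. 0 §1] -/
theorem exists_liftedCurve {k i j : Fin (2 + 2)} (e : OpenPartialHomeomorph M ((Fin 2 → ℂ) × (Fin 0 → ℂ)))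
    {x₀ : M} (hx₀ : x₀ ∈ e.source)
    (hesymm : MDifferentiableOn 𝓘(ℂ, (Fin 2 → ℂ) × (Fin 0 → ℂ)) 𝓘(ℂ, E) e.symm e.target)
    (he1 : ∀ y ∈ e.source, (e y).1 = ![projLift ψ k y i, projLift ψ k y j])
    {r₁ r₂ : ℂ → ℂ} {t₀ : ℂ} (hr₁ : AnalyticAt ℂ r₁ t₀) (hr₂ : AnalyticAt ℂ r₂ t₀)
    (hr₁₀ : r₁ t₀ = projLift ψ k x₀ i) (hr₂₀ : r₂ t₀ = projLift ψ k x₀ j) :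
    ∃ Γ : ℂ → M, Γ t₀ = x₀ ∧ MDifferentiableAt 𝓘(ℂ, ℂ) 𝓘(ℂ, E) Γ t₀ ∧
      ∀ᶠ t in 𝓝 t₀, Γ t ∈ e.source ∧ MDifferentiableAt 𝓘(ℂ, ℂ) 𝓘(ℂ, E) Γ t ∧
        projLift ψ k (Γ t) i = r₁ t ∧ projLift ψ k (Γ t) j = r₂ t := by
  -- the curve in the target of `e`
  set c : ℂ → (Fin 2 → ℂ) × (Fin 0 → ℂ) := fun t ↦ (![r₁ t, r₂ t], finZeroElim) with hc
  have hc₀ : c t₀ = e x₀ := by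
    have h1 := he1 x₀ hx₀
    refine Prod.ext ?_ (Subsingleton.elim _ _)
    change ![r₁ t₀, r₂ t₀] = (e x₀).1
    rw [h1, hr₁₀, hr₂₀]
  have hcan : AnalyticAt ℂ c t₀ := by
    refine AnalyticAt.prod ?_ analyticAt_const
    refine (analyticAt_pi_iff).mpr fun r ↦ ?_
    fin_cases r
    · exact hr₁
    · exact hr₂
  have hct : ∀ᶠ t in 𝓝 t₀, c t ∈ e.target := by
    have hmem : e.target ∈ 𝓝 (c t₀) := by
      rw [hc₀]; exact e.open_target.mem_nhds (e.map_source hx₀)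
    exact hcan.continuousAt.preimage_mem_nhds hmem
  set Γ : ℂ → M := fun t ↦ e.symm (c t) with hΓ
  -- differentiability of `Γ` wherever `c` is analytic and lands in the target
  have hdiff : ∀ t, AnalyticAt ℂ c t → c t ∈ e.target → MDifferentiableAt 𝓘(ℂ, ℂ) 𝓘(ℂ, E) Γ t := by
    intro t hct' htt
    have h1 : MDifferentiableAt 𝓘(ℂ, (Fin 2 → ℂ) × (Fin 0 → ℂ)) 𝓘(ℂ, E) e.symm (c t) :=
      (hesymm _ htt).mdifferentiableAt (e.open_target.mem_nhds htt)
    have h2 : MDifferentiableAt 𝓘(ℂ, ℂ) 𝓘(ℂ, (Fin 2 → ℂ) × (Fin 0 → ℂ)) c t :=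
      mdifferentiableAt_iff_differentiableAt.mpr hct'.differentiableAt
    exact h1.comp t h2
  refine ⟨Γ, ?_, hdiff t₀ hcan (hc₀ ▸ e.map_source hx₀), ?_⟩
  · simp only [hΓ, hc₀, e.left_inv hx₀]
  · filter_upwards [hct, hcan.eventually_analyticAt] with t ht hta
    have hsrc : Γ t ∈ e.source := e.map_target ht
    have het : e (Γ t) = c t := e.right_inv ht
    have h1 := he1 (Γ t) hsrc
    rw [het] at h1
    change ![r₁ t, r₂ t] = ![projLift ψ k (Γ t) i, projLift ψ k (Γ t) j] at h1
    refine ⟨hsrc, hdiff t hta ht, ?_, ?_⟩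
    · have := congrFun h1 0; simpa using this.symm
    · have := congrFun h1 1; simpa using this.symm

end Surface

end Literature.AlgebraicGeometry.HodgeTheory

end
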